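import Literature.NumberTheory.EllipticCurves.Rank1Residual.X11RankOneCertificates.Schema
import Literature.NumberTheory.EllipticCurves.Rank1Residual.Typed.PAdicCertificateMultiplicativeExists
import Literature.NumberTheory.EllipticCurves.KatoRankBoundProofs
import Literature.NumberTheory.EllipticCurves.IwasawaSelmerDualProofs
import Literature.NumberTheory.EllipticCurves.PAdicBSDSplitMultiplicativeProofs
import Literature.NumberTheory.EllipticCurves.PAdicHeightsProofs
import Literature.NumberTheory.EllipticCurves.PAdicHeightsLInvariantHoldsProofs
import Literature.NumberTheory.EllipticCurves.LeadingTermPPartProofs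
import Literature.NumberTheory.EllipticCurves.ModularCurve
import HarnessLib

/-!
# X11 at rank one beyond `p = 3`: what a certificate record CLAIMS about its curve, and `BSD(E,p)` from the claim

HONEST FRAMING (cell `b2b-bsdres`, run/shared/lean/b2b/bsd-rank1-residual/, verbatim): prove what is
provable now; shrink each hard class to its core with data; no claim beyond stated classes. The cell
deletes COMBINATION-shaped residual classes from PUBLISHED theorems only; the CONSTRUCTION-shaped
remainder is typed, not attempted. This is not "finishing BSD". Class X11b (multiplicative `p`, `r = 1`)
stays CONSTRUCTION-SHAPED (referee A G24): the missing object is the per-curve COMPUTATION below, now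
entered record by record.

Companion of `Schema.lean` (the record FORMAT and its in-kernel recheck) and of the data files
`Records*.lean`. This file says, in the tree's vocabulary, what a record MEANS for its curve
(`Record.Claim`, a `Prop` to be taken as an explicit hypothesis `(h : r.Claim)`, D-0014 style: it is
the conjunction of the per-pair HYPOTHESIS CERTIFICATES — analytic rank `1`, multiplicative reduction at
`p`, `E[p]` irreducible, non-semistability, surjectivity of `ρ̄_{E,p}` when Serre witnesses are recorded,
the (ram) witnesses, the split/non-split type, `#Ш_an` — and of the per-pair `p`-ADIC CERTIFICATE
(`Record.CertSplit` / `Record.CertNonsplit`: for THE newform, THE period ratio `ϖ`, THE `p`-adic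
`L`-function and THE Stein–Wuthrich height — all unique —, `ord_{T=0} L_p = r + e` and the valuation
identity `ord_p(ϖ·[T^{r+e}]L_p·log_p(γ)^{r+e}·#E(ℚ)_tors²) = ord_p(A·Reg_p)` with `A = 𝓛_p·∏c_v`
(split) / `2∏c_v` (non-split); this is the quantity the two engines compute as `v_p(S_p) = 0`,
dictionary in `Typed/PAdicCertificateMultiplicativeCanonical.lean`), computed by the engines named in the
record — and proves that the claim together with the PUBLISHED named facts gives Miller's `BSD(E,p)`
(`Literature.NumberTheory.EllipticCurves.BSDp`) for the record's model:

* `Record.bsdp_of_claim_of_split_of_surj` / `…_of_nonsplit_of_surj` — route F35 (Kato's divisibility for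
  surjective `ρ_{E,p^∞}`, Wuthrich 2014 Thm. 3 / Cor. 19 = Stein–Wuthrich 2013 Thm. 7.3; `Surj W p` at
  `p ≥ 5` gives every `p^n` by Serre, PROVED) ∘ Stein–Wuthrich 2013 Thm. 6.1 (Jones) ∘ the certificate
  engine: x11a's `Typed.X11.bsdp_of_katoSurj_{split,nonsplit}_of_surjective_pow_of_certificate`;
* `Record.bsdp_of_claim_of_split_of_ram` / `…_of_nonsplit_of_ram` — route Skinner 2016 Thm. A ((ram)):
  `Typed.X11.bsdp_of_thmA_{split,nonsplit}_of_certificate`;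
* `Record.bsdp_of_claim` — dispatcher on (`split`, source), and `bsdp_of_certified_of_claims` — the
  list form used by the `Records*.lean` headline theorems.

The bookkeeping data of x11a's theorems are INSTANTIATED here from tree THEOREMS, not assumed:
`(κ, γ)` by `exists_isCyclotomic_isTopGenerator_isCyclotomicVariable_holds`, `X(E/ℚ_∞)` by
`nonempty_selmerDualData_holds`, the newform and `ϖ` by the modular parametrisation
(`nonempty_modularParametrizationData`, a named fact = modularity, and
`ModularParametrizationData.exists_rat_mul_realPeriodRat_eq_plusPeriod`, proved), `L_p` at a split prime
by `exists_isSplitMultPAdicLFunctionOf` (proved; MTT §I.10–I.14), the Tate parameter by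
`nonempty_tateParameterData_iff_holds` / `existsUnique_tateJ_eq_of_one_lt_norm` (proved), `𝓛_p ≠ 0` by
`LInvariant_ne_zero_holds` (proved, Barré-Sirieix–Diaz–Gramain–Philibert). ONE bookkeeping existence
is a NEW named fact of this file: `exists_isMultPAdicLFunctionOf_neg_one` (MTT 1986 §I.10–§I.14 with
the unit root `α = a_p = −1`: the `p`-adic `L`-function at a NON-split multiplicative prime exists; the
split twin is proved in `PAdicBSDSplitMultiplicativeProofs`, the non-split one is not yet).

Trust base of `BSDp r.curve r.p` for a certified record: the named facts in the hypotheses (Kato /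
Skinner A, SW Thm. 6.1, SW §4.2 height existence, Wuthrich Prop. 21, GZK, modularity ×2, MTT non-split
existence), the record's `Claim` (the computation: engines T/Y/P of unit `b2b-bsdres-x11c` for the
hypothesis certificates; PARI j042099/j042317/j042338 (x11a gen 4) and msengine j048000 (lit gen 7) for
the `p`-adic certificate), and global minimality of Cremona's model (instance hypothesis). Per curve; NOT
a deletion of X11; no verdict of the lane is changed by this file.

References: Serre 1972 Prop. 19 [Serre1972]; Mazur–Tate–Teitelbaum 1986 §I.10–I.14, §II.10
[MazurTateTeitelbaum1986Invent]; Stein–Wuthrich 2013 Thm. 6.1, Thm. 7.3, §4.2 [SteinWuthrich2013];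
Wuthrich 2014 Thm. 3, Cor. 19, Prop. 21 [Wuthrich2014]; Skinner 2016 Thm. A [Skinner2016PacificMC];
Miller 2011 Def. 1.1, Prop. 7.6 [Miller2011LMS]; Cremona's tables [Cremona2006].
-/

set_option autoImplicit false

noncomputable section

open scoped Classical MatrixGroups ModularForm

open CongruenceSubgroup WeierstrassCurve Literature.NumberTheory.EllipticCurves
  Literature.NumberTheory.EllipticCurves.ModularForms
  Literature.NumberTheory.EllipticCurves.Rank1Residual
  Literature.NumberTheory.EllipticCurves.Rank1Residual.Typed
  Literature.NumberTheory.EllipticCurves.Skinner2016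
  Literature.NumberTheory.EllipticCurves.Wuthrich2014
  Literature.NumberTheory.EllipticCurves.SteinWuthrich2013

namespace Literature.NumberTheory.EllipticCurves.Rank1Residual.X11RankOneCertificates

/-! ### The one bookkeeping existence not yet proved in the tree -/

/-- **Existence of the Mazur–Tate–Teitelbaum `p`-adic `L`-function at a prime of NON-split
multiplicative reduction** (Mazur–Tate–Teitelbaum, Invent. Math. 84 (1986), §I.10 Proposition — the
distribution `μ_{f,α}` of an allowable root, here the unit `α = a_p = −1`, `ε(p) = 0` since `p ∣ N` —,
§I.11 (bounded, `α` a unit), §I.12–§I.14 (14.3): its Mellin transform `L ∈ Λ ⊗ ℚ_p` interpolates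
`α^{-m} ∑_{a mod p^m} χ(a)[a/p^m]⁺` and has `L(0) = (1 − α⁻¹)[0]⁺ = 2[0]⁺`): if `E/ℚ` has non-split
multiplicative reduction at `p` and `f` is its newform, some `L` satisfies
`IsMultPAdicLFunctionOf f p (-1) L`. The split twin (`α = 1`) is the tree THEOREM
`exists_isSplitMultPAdicLFunctionOf`; this clause is the same construction with `α = −1`, stated as a
named fact. [cite: MazurTateTeitelbaum1986Invent, §I.10 Prop. and §I.14 (14.3)] -/
def exists_isMultPAdicLFunctionOf_neg_one : Prop :=
  ∀ (W : WeierstrassCurve ℚ) [W.IsElliptic] (p : ℕ) [Fact p.Prime] {N : ℕ} [NeZero N]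
    (f : CuspForm (Gamma0 N) 2), W.HasMultiplicativeReductionAtPrime p →
    ¬ W.HasSplitMultiplicativeReductionAtPrime p → IsNewformOf W f →
      ∃ L : PowerSeries ℚ_[p], IsMultPAdicLFunctionOf f p (-1) L

/-! ### The record's curve and the claims -/

namespace Record

/-- The Weierstrass equation over `ℚ` with the record's a-invariants (junk: the zero equation when
`ainvs` does not have five entries — excluded by `Record.check`). For the cell's records this is
Cremona's reduced global minimal model of the curve `label`. [folklore] -/
def curve (r : Record) : WeierstrassCurve ℚ :=
  match r.ainvs with
  | [a₁, a₂, a₃, a₄, a₆] => ⟨a₁, a₂, a₃, a₄, a₆⟩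
  | _ => ⟨0, 0, 0, 0, 0⟩

/-- **The `p`-adic certificate at a SPLIT multiplicative prime, rank one** (the computed claim behind
`ordT = 2`, `vS = 0`): for every newform `f` of the curve, every `ϖ ∈ ℚ` with `ϖ·Ω(W) = Ω⁺_f` and every
`L` with `IsSplitMultPAdicLFunctionOf f p L` (each unique), `ord_{T=0} L = 2` and, for every Tate
parameter datum `Dq` and every height datum `Dh` pinned to Stein–Wuthrich's §4.2 height
(`IsSplitMultCanonical Dh Dq`, unique), `ord_p(ϖ·[T²]L·log_p(γ_cyc)²·#E(ℚ)_tors²) =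
ord_p(𝓛_p(E)·∏c_v·Reg_p(E,Dh))` — the hypothesis `hordL`/`hcert` of
`Typed.X11.bsdp_of_katoSurj_split_of_surjective_pow_of_certificate` with `r = 1`. PARI/GP computes the
two sides as `ellpadicL`/`ellpadicbsd` and `ellpadicregulator` (MTT §II.10 normalisation); a claim, not
checked by the kernel. [cite: MazurTateTeitelbaum1986Invent, §II.10] -/
def CertSplit (r : Record) [Fact r.p.Prime] [r.curve.IsElliptic] : Prop :=
  ∀ {N : ℕ} [NeZero N] (f : CuspForm (Gamma0 N) 2) (ϖ : ℚ) (L : PowerSeries ℚ_[r.p]),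
    IsNewformOf r.curve f → (ϖ : ℝ) * r.curve.realPeriodRat = plusPeriod f →
    IsSplitMultPAdicLFunctionOf f r.p L →
      L.order = (2 : ℕ) ∧
      ∀ (Dq : TateParameterData r.curve r.p) (Dh : PAdicHeightData r.curve r.p),
        IsSplitMultCanonical Dh Dq →
        ((((ϖ : ℚ) : ℚ_[r.p]) * PowerSeries.coeff 2 L *
            (padicLog r.p (cyclotomicGenerator r.p) ^ 2 * (r.curve.torsionOrder : ℚ_[r.p]) ^ 2)).valuation =
          (LInvariant Dq * (r.curve.tamagawaProduct : ℚ_[r.p]) * padicRegulator Dh).valuation)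

/-- **The `p`-adic certificate at a NON-SPLIT multiplicative prime, rank one** (`ordT = 1`, `vS = 0`):
for every newform `f`, `ϖ`, and `L` with `IsMultPAdicLFunctionOf f p (-1) L`: `ord_{T=0} L = 1` and, for
the Tate parameter `q` of `E/ℚ_p` and every `Dh` pinned to Stein–Wuthrich's height (formula (4.1),
`IsMultCanonical Dh q`), `ord_p(ϖ·[T¹]L·log_p(γ_cyc)·#E(ℚ)_tors²) = ord_p(2·∏c_v·Reg_p(E,Dh))`
(`ε_p = 2`). A claim, not checked by the kernel. [cite: MazurTateTeitelbaum1986Invent, §II.10]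
[cite: SteinWuthrich2013, §3.1 (p. 9) and §4.2] -/
def CertNonsplit (r : Record) [Fact r.p.Prime] [r.curve.IsElliptic] : Prop :=
  ∀ {N : ℕ} [NeZero N] (f : CuspForm (Gamma0 N) 2) (ϖ : ℚ) (L : PowerSeries ℚ_[r.p]),
    IsNewformOf r.curve f → (ϖ : ℝ) * r.curve.realPeriodRat = plusPeriod f →
    IsMultPAdicLFunctionOf f r.p (-1) L →
      L.order = (1 : ℕ) ∧
      ∀ (q : ℚ_[r.p]), q ≠ 0 → ‖q‖ < 1 → tateJ q = (r.curve.j : ℚ_[r.p]) →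
        ∀ (Dh : PAdicHeightData r.curve r.p), IsMultCanonical Dh q →
        ((((ϖ : ℚ) : ℚ_[r.p]) * PowerSeries.coeff 1 L *
            (padicLog r.p (cyclotomicGenerator r.p) ^ 1 * (r.curve.torsionOrder : ℚ_[r.p]) ^ 2)).valuation =
          (2 * (r.curve.tamagawaProduct : ℚ_[r.p]) * padicRegulator Dh).valuation)

/-- **What a certificate record CLAIMS about its curve** `W = r.curve` (for the record's own model,
assumed globally minimal — Cremona's reduced minimal model): analytic rank `1`; multiplicative reduction
at `p`; `E[p]` irreducible; `E` not semistable; `ρ̄_{E,p}` surjective if Serre witnesses are recorded;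
the (ram) condition if (ram) witnesses are recorded; split resp. non-split type as recorded; Miller's
`#Ш_an = r.shaAn`; and the `p`-adic certificate `CertSplit` resp. `CertNonsplit`. Each conjunct is the
OUTPUT of the two-engine computation named in `r.engines` (unit `b2b-bsdres-x11c`: engine T tables +
exact arithmetic, engine Y independent python numerics, engine P PARI/cypari2; `p`-adic part: PARI x11a
gen 4 + msengine lit gen 7). A `Prop` to be ASSUMED, `(h : r.Claim)`; nothing in the tree proves it.
[folklore] -/
def Claim (r : Record) : Prop :=
  ∀ [Fact r.p.Prime] [r.curve.IsElliptic] [r.curve.IsGloballyMinimal],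
    r.curve.analyticRank = 1 ∧ Mult r.curve r.p ∧ Irr r.curve r.p ∧ ¬ Semistable r.curve ∧
    (r.serre ≠ [] → Surj r.curve r.p) ∧ (r.ram ≠ [] → Ram r.curve r.p) ∧
    (r.split = true → r.curve.HasSplitMultiplicativeReductionAtPrime r.p) ∧
    (r.split = false → ¬ r.curve.HasSplitMultiplicativeReductionAtPrime r.p) ∧
    _root_.Literature.NumberTheory.EllipticCurves.shaAn r.curve = ((r.shaAn : ℚ) : ℂ) ∧
    (r.split = true → r.CertSplit) ∧ (r.split = false → r.CertNonsplit)

end Record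

/-- The claims of a list of records: every record's `Claim`. [folklore] -/
def Claims (rs : List Record) : Prop := ∀ r ∈ rs, r.Claim

/-! ### From the claim and the published facts to `BSD(E,p)` -/

/-- `ord_p (r.shaAn : ℚ) = 0` for a certified record (`p ∤ shaAn`). [folklore] -/
theorem Record.padicValRat_shaAn_eq_zero (r : Record) (hc : r.check = true) :
    padicValRat r.p (r.shaAn : ℚ) = 0 := by
  rw [padicValRat.of_nat]
  exact_mod_cast padicValNat.eq_zero_of_not_dvd (r.shaAn_of_check hc).1

section Consumers

variable (r : Record) [Fact r.p.Prime] [r.curve.IsElliptic] [r.curve.IsGloballyMinimal]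

/-- `ClassX11 W p` (clause `r = 1 ∧ ¬sst`) from the claim. [folklore] -/
theorem Record.classX11_of_claim (h : r.Claim) : ClassX11 r.curve r.p := by
  obtain ⟨hran, hmult, hirr, hnsst, -⟩ := h
  exact ⟨hmult, hirr, Or.inr (Or.inl ⟨hran, hnsst⟩)⟩

/-- **Split multiplicative `p ≥ 5`, Serre witnesses recorded: `BSD(E,p)` for the record's curve** from the
PUBLISHED facts (Kato–Wuthrich surjective divisibility `hK`, Stein–Wuthrich Thm. 6.1 `hJ`, SW §4.2 height
existence `hH`, Wuthrich Prop. 21 `hW`, GZK, modularity `hmod`/`hpar`) and the record's `Claim`. All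
bookkeeping data instantiated from tree theorems (module docstring). Per curve.
[cite: SteinWuthrich2013, Thm. 6.1 (p. 20), Thm. 7.3 (p. 22), §4.2] [cite: Wuthrich2014, Cor. 19 (p. 398), Prop. 21 (p. 400)] -/
theorem Record.bsdp_of_claim_of_split_of_surj
    (hK : kato_charIdeal_dvd_multiplicative_of_surjective) (hJ : thm61_splitMultiplicative)
    (hH : exists_isSplitMultCanonical) (hW : Wuthrich2014.sha_dvd_analyticSha)
    (hGZK : rank_eq_analyticRank_of_analyticRank_le_one) (hmod : hasEntireLFunction_rat)
    (hpar : nonempty_modularParametrizationData)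
    (hc : r.check = true) (hsplit : r.split = true) (hserre : r.serre ≠ []) (h : r.Claim) :
    BSDp r.curve r.p := by
  obtain ⟨hran, hmult, hirr, hnsst, hsurj, -, hsp, -, hsha, hcs, -⟩ := h
  have hp5 : 5 ≤ r.p := r.five_le_of_check hc
  have hX : ClassX11 r.curve r.p := ⟨hmult, hirr, Or.inr (Or.inl ⟨hran, hnsst⟩)⟩
  have hsplit' := hsp hsplit
  obtain ⟨κ, hκ, γ, hγ, hγ'⟩ := exists_isCyclotomic_isTopGenerator_isCyclotomicVariable_holds r.p
  obtain ⟨D⟩ := r.curve.nonempty_selmerDualData_holds κ γ hγ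
  haveI : NeZero (r.curve.conductorNorm ℤ) := ⟨(r.curve.conductorNorm_pos_holds).ne'⟩
  obtain ⟨Dm⟩ := hpar r.curve
  obtain ⟨ϖ, hϖpos, hϖ, -⟩ := Dm.exists_rat_mul_realPeriodRat_eq_plusPeriod
  obtain ⟨L, hL⟩ := exists_isSplitMultPAdicLFunctionOf hsplit' Dm.isNewformOf
  obtain ⟨Dq⟩ := (nonempty_tateParameterData_iff_holds (W := r.curve) (p := r.p)).mpr hsplit'
  have hrank : r.curve.mordellWeilRank = 1 := by rw [(hGZK r.curve (le_of_eq hran)).1, hran]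
  obtain ⟨hordL, hcert⟩ := hcs hsplit Dm.f ϖ L Dm.isNewformOf hϖ hL
  exact X11.bsdp_of_katoSurj_split_of_surjective_pow_of_certificate hK hJ hH hW hGZK hmod r.curve r.p
    LInvariant_ne_zero_holds (by omega) (le_of_eq hran) hX
    (kato_charIdeal_dvd_multiplicative_of_surjective.surjective_pow_of_five_le r.curve r.p hp5 (hsurj hserre))
    Dq hκ hγ hγ' Dm.isNewformOf D ϖ hϖpos.ne' hϖ L hL (by rw [hrank]; exact hordL)
    (fun Dh hDh => by rw [hrank]; exact hcert Dq Dh hDh) hsha (r.padicValRat_shaAn_eq_zero hc)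

/-- **Non-split multiplicative `p ≥ 5`, Serre witnesses recorded: `BSD(E,p)` for the record's curve**,
with the one extra named fact `hLns : exists_isMultPAdicLFunctionOf_neg_one` (existence of `L_p`).
[cite: SteinWuthrich2013, Thm. 6.1 (p. 20), §3.1 (p. 9), §4.2] [cite: Wuthrich2014, Thm. 3 (p. 383), Prop. 21 (p. 400)] -/
theorem Record.bsdp_of_claim_of_nonsplit_of_surj
    (hK : kato_charIdeal_dvd_multiplicative_of_surjective) (hJ : thm61_nonsplitMultiplicative)
    (hH : exists_isMultCanonical) (hW : Wuthrich2014.sha_dvd_analyticSha)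
    (hGZK : rank_eq_analyticRank_of_analyticRank_le_one) (hmod : hasEntireLFunction_rat)
    (hpar : nonempty_modularParametrizationData) (hLns : exists_isMultPAdicLFunctionOf_neg_one)
    (hc : r.check = true) (hsplit : r.split = false) (hserre : r.serre ≠ []) (h : r.Claim) :
    BSDp r.curve r.p := by
  obtain ⟨hran, hmult, hirr, hnsst, hsurj, -, -, hnsp, hsha, -, hcn⟩ := h
  have hp5 : 5 ≤ r.p := r.five_le_of_check hc
  have hX : ClassX11 r.curve r.p := ⟨hmult, hirr, Or.inr (Or.inl ⟨hran, hnsst⟩)⟩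
  have hns := hnsp hsplit
  obtain ⟨κ, hκ, γ, hγ, hγ'⟩ := exists_isCyclotomic_isTopGenerator_isCyclotomicVariable_holds r.p
  obtain ⟨D⟩ := r.curve.nonempty_selmerDualData_holds κ γ hγ
  haveI : NeZero (r.curve.conductorNorm ℤ) := ⟨(r.curve.conductorNorm_pos_holds).ne'⟩
  obtain ⟨Dm⟩ := hpar r.curve
  obtain ⟨ϖ, hϖpos, hϖ, -⟩ := Dm.exists_rat_mul_realPeriodRat_eq_plusPeriod
  obtain ⟨L, hL⟩ := hLns r.curve r.p Dm.f hmult hns Dm.isNewformOf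
  obtain ⟨q, ⟨hq0, hq1, hqj⟩, -⟩ := existsUnique_tateJ_eq_of_one_lt_norm
    (one_lt_norm_j_of_hasMultiplicativeReductionAtPrime (W := r.curve) (p := r.p) hmult)
  have hrank : r.curve.mordellWeilRank = 1 := by rw [(hGZK r.curve (le_of_eq hran)).1, hran]
  obtain ⟨hordL, hcert⟩ := hcn hsplit Dm.f ϖ L Dm.isNewformOf hϖ hL
  exact X11.bsdp_of_katoSurj_nonsplit_of_surjective_pow_of_certificate hK hJ hH hW hGZK hmod r.curve r.p
    (by omega) (le_of_eq hran) hX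
    (kato_charIdeal_dvd_multiplicative_of_surjective.surjective_pow_of_five_le r.curve r.p hp5 (hsurj hserre))
    hns hq0 hq1 hqj hκ hγ hγ' Dm.isNewformOf D ϖ hϖpos.ne' hϖ L hL (by rw [hrank]; exact hordL)
    (fun Dh hDh => by rw [hrank, pow_one]; simpa using hcert q hq0 hq1 hqj Dh hDh) hsha
    (r.padicValRat_shaAn_eq_zero hc)

/-- **Split multiplicative `p ≥ 5`, (ram) witnesses recorded: `BSD(E,p)`** by Skinner 2016 Thm. A (`hA`)
instead of the surjective-image divisibility. [cite: Skinner2016PacificMC, Thm. A]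
[cite: SteinWuthrich2013, Thm. 6.1 (p. 20) and §4.2] -/
theorem Record.bsdp_of_claim_of_split_of_ram
    (hA : thmA_charIdeal_multiplicative) (hJ : thm61_splitMultiplicative)
    (hH : exists_isSplitMultCanonical) (hW : Wuthrich2014.sha_dvd_analyticSha)
    (hGZK : rank_eq_analyticRank_of_analyticRank_le_one) (hmod : hasEntireLFunction_rat)
    (hpar : nonempty_modularParametrizationData)
    (hc : r.check = true) (hsplit : r.split = true) (hram : r.ram ≠ []) (h : r.Claim) :
    BSDp r.curve r.p := by
  obtain ⟨hran, hmult, hirr, hnsst, -, hram', hsp, -, hsha, hcs, -⟩ := h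
  have hp5 : 5 ≤ r.p := r.five_le_of_check hc
  have hX : ClassX11 r.curve r.p := ⟨hmult, hirr, Or.inr (Or.inl ⟨hran, hnsst⟩)⟩
  have hsplit' := hsp hsplit
  obtain ⟨κ, hκ, γ, hγ, hγ'⟩ := exists_isCyclotomic_isTopGenerator_isCyclotomicVariable_holds r.p
  obtain ⟨D⟩ := r.curve.nonempty_selmerDualData_holds κ γ hγ
  haveI : NeZero (r.curve.conductorNorm ℤ) := ⟨(r.curve.conductorNorm_pos_holds).ne'⟩
  obtain ⟨Dm⟩ := hpar r.curve
  obtain ⟨ϖ, hϖpos, hϖ, -⟩ := Dm.exists_rat_mul_realPeriodRat_eq_plusPeriod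
  obtain ⟨L, hL⟩ := exists_isSplitMultPAdicLFunctionOf hsplit' Dm.isNewformOf
  obtain ⟨Dq⟩ := (nonempty_tateParameterData_iff_holds (W := r.curve) (p := r.p)).mpr hsplit'
  have hrank : r.curve.mordellWeilRank = 1 := by rw [(hGZK r.curve (le_of_eq hran)).1, hran]
  obtain ⟨hordL, hcert⟩ := hcs hsplit Dm.f ϖ L Dm.isNewformOf hϖ hL
  exact X11.bsdp_of_thmA_split_of_certificate hA hJ hH hW hGZK hmod r.curve r.p LInvariant_ne_zero_holds
    (by omega) (le_of_eq hran) hX (hram' hram) Dq hκ hγ hγ' Dm.isNewformOf D ϖ hϖpos.ne' hϖ L hL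
    (by rw [hrank]; exact hordL) (fun Dh hDh => by rw [hrank]; exact hcert Dq Dh hDh) hsha
    (r.padicValRat_shaAn_eq_zero hc)

/-- **Non-split multiplicative `p ≥ 5`, (ram) witnesses recorded: `BSD(E,p)`** by Skinner 2016 Thm. A.
[cite: Skinner2016PacificMC, Thm. A] [cite: SteinWuthrich2013, Thm. 6.1 (p. 20), §3.1 (p. 9), §4.2] -/
theorem Record.bsdp_of_claim_of_nonsplit_of_ram
    (hA : thmA_charIdeal_multiplicative) (hJ : thm61_nonsplitMultiplicative)
    (hH : exists_isMultCanonical) (hW : Wuthrich2014.sha_dvd_analyticSha)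
    (hGZK : rank_eq_analyticRank_of_analyticRank_le_one) (hmod : hasEntireLFunction_rat)
    (hpar : nonempty_modularParametrizationData) (hLns : exists_isMultPAdicLFunctionOf_neg_one)
    (hc : r.check = true) (hsplit : r.split = false) (hram : r.ram ≠ []) (h : r.Claim) :
    BSDp r.curve r.p := by
  obtain ⟨hran, hmult, hirr, hnsst, -, hram', -, hnsp, hsha, -, hcn⟩ := h
  have hp5 : 5 ≤ r.p := r.five_le_of_check hc
  have hX : ClassX11 r.curve r.p := ⟨hmult, hirr, Or.inr (Or.inl ⟨hran, hnsst⟩)⟩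
  have hns := hnsp hsplit
  obtain ⟨κ, hκ, γ, hγ, hγ'⟩ := exists_isCyclotomic_isTopGenerator_isCyclotomicVariable_holds r.p
  obtain ⟨D⟩ := r.curve.nonempty_selmerDualData_holds κ γ hγ
  haveI : NeZero (r.curve.conductorNorm ℤ) := ⟨(r.curve.conductorNorm_pos_holds).ne'⟩
  obtain ⟨Dm⟩ := hpar r.curve
  obtain ⟨ϖ, hϖpos, hϖ, -⟩ := Dm.exists_rat_mul_realPeriodRat_eq_plusPeriod
  obtain ⟨L, hL⟩ := hLns r.curve r.p Dm.f hmult hns Dm.isNewformOf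
  obtain ⟨q, ⟨hq0, hq1, hqj⟩, -⟩ := existsUnique_tateJ_eq_of_one_lt_norm
    (one_lt_norm_j_of_hasMultiplicativeReductionAtPrime (W := r.curve) (p := r.p) hmult)
  have hrank : r.curve.mordellWeilRank = 1 := by rw [(hGZK r.curve (le_of_eq hran)).1, hran]
  obtain ⟨hordL, hcert⟩ := hcn hsplit Dm.f ϖ L Dm.isNewformOf hϖ hL
  exact X11.bsdp_of_thmA_nonsplit_of_certificate hA hJ hH hW hGZK hmod r.curve r.p (by omega)
    (le_of_eq hran) hX (hram' hram) hns hq0 hq1 hqj hκ hγ hγ' Dm.isNewformOf D ϖ hϖpos.ne' hϖ L hL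
    (by rw [hrank]; exact hordL)
    (fun Dh hDh => by rw [hrank, pow_one]; simpa using hcert q hq0 hq1 hqj Dh hDh) hsha
    (r.padicValRat_shaAn_eq_zero hc)

/-- **The published inputs of the X11 rank-one certificate route, bundled** (all named facts of the
tree; nothing new except `exists_isMultPAdicLFunctionOf_neg_one` above): Kato–Wuthrich surjective
divisibility, Skinner 2016 Thm. A, Stein–Wuthrich 2013 Thm. 6.1 (split / non-split), SW §4.2 height
existence (split / non-split), Wuthrich 2014 Prop. 21, Gross–Zagier–Kolyvagin, modularity (entire
`L`-function; modular parametrisation), MTT non-split existence. [folklore] -/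
structure Inputs : Prop where
  /-- Kato's divisibility at an odd multiplicative prime for surjective `ρ_{E,p^∞}` (Wuthrich 2014 Thm. 3 / Cor. 19; SW 2013 Thm. 7.3). -/
  kato : kato_charIdeal_dvd_multiplicative_of_surjective
  /-- Skinner 2016 Thm. A (the multiplicative main conjecture under (irr), (ram)). -/
  thmA : thmA_charIdeal_multiplicative
  /-- Stein–Wuthrich 2013 Thm. 6.1 at a split multiplicative prime. -/
  jonesSplit : thm61_splitMultiplicative
  /-- Stein–Wuthrich 2013 Thm. 6.1 at a non-split multiplicative prime. -/
  jonesNonsplit : thm61_nonsplitMultiplicative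
  /-- existence of the SW §4.2 height datum, split case. -/
  heightSplit : exists_isSplitMultCanonical
  /-- existence of the SW §4.2 height datum, non-split case. -/
  heightNonsplit : exists_isMultCanonical
  /-- Wuthrich 2014 Prop. 21 (`#Ш ∣ #Ш_an` shape at rank `≤ 1`). -/
  wuthrich : Wuthrich2014.sha_dvd_analyticSha
  /-- Gross–Zagier–Kolyvagin: rank `=` analytic rank `≤ 1` and `Ш` finite. -/
  gzk : rank_eq_analyticRank_of_analyticRank_le_one
  /-- modularity: `L(E,s)` entire. -/
  modular : hasEntireLFunction_rat
  /-- modularity: a modular parametrisation by `X₀(N)`. -/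
  parametrisation : nonempty_modularParametrizationData
  /-- MTT 1986: the `p`-adic `L`-function at a non-split multiplicative prime exists. -/
  mttNonsplit : exists_isMultPAdicLFunctionOf_neg_one

/-- **Dispatcher: `BSD(E,p)` for the record's curve from the inputs, a passing recheck and the claim**
(split / non-split by `r.split`; divisibility source by `Record.source_of_check`: Serre witnesses ⇒ F35,
else (ram) ⇒ Skinner Thm. A). [folklore] -/
theorem Record.bsdp_of_claim (I : Inputs) (hc : r.check = true) (h : r.Claim) : BSDp r.curve r.p := by
  rcases r.source_of_check hc with hserre | hram
  · cases hs : r.split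
    · exact r.bsdp_of_claim_of_nonsplit_of_surj I.kato I.jonesNonsplit I.heightNonsplit I.wuthrich I.gzk
        I.modular I.parametrisation I.mttNonsplit hc hs hserre h
    · exact r.bsdp_of_claim_of_split_of_surj I.kato I.jonesSplit I.heightSplit I.wuthrich I.gzk I.modular
        I.parametrisation hc hs hserre h
  · cases hs : r.split
    · exact r.bsdp_of_claim_of_nonsplit_of_ram I.thmA I.jonesNonsplit I.heightNonsplit I.wuthrich I.gzk
        I.modular I.parametrisation I.mttNonsplit hc hs hram h
    · exact r.bsdp_of_claim_of_split_of_ram I.thmA I.jonesSplit I.heightSplit I.wuthrich I.gzk I.modular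
        I.parametrisation hc hs hram h

end Consumers

/-- **List form**: for a `Certified` list of records whose claims hold, `BSD(E,p)` holds for every
listed pair (for the record's model, assumed globally minimal). This is the shape of the headline
theorems of the `Records*.lean` files. [folklore] -/
theorem bsdp_of_certified_of_claims (I : Inputs) {rs : List Record} (hC : Certified rs)
    (hcl : Claims rs) (r : Record) (hr : r ∈ rs)
    [Fact r.p.Prime] [r.curve.IsElliptic] [r.curve.IsGloballyMinimal] : BSDp r.curve r.p :=
  r.bsdp_of_claim I (hC.check_of_mem hr) (hcl r hr)

end Literature.NumberTheory.EllipticCurves.Rank1Residual.X11RankOneCertificates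

end
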